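import Summits.QuantumFields.BalabanUV.T4Continuum.Support.BalabanAveragedTowerModes

/-!
# T⁴ programme, spine node NE2 (U1a) — A DISCRETE BLOCK POINCARÉ INEQUALITY on the torus, in operator form:
# `‖(1 − Π_R) X‖ ≤ 2d·C/N` whenever `‖∇^{(RN)}_ν X‖ ≤ C` (`Π_R = R^d Q_Rᴴ Q_R` the projector onto `R`-block-constant fields)
# — the tool for the MIXED ONE-STEP LAW of the companion leaf `Support/BalabanMinimizerLaw`

Eighth generation of the NE2 prover lineage P1 of the cell `pub-balaban`, file 6.  Files 2–5 treat the SANDWICHED objects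
`Q X Qᴴ` (covariances of averaged fields).  The un-sandwiched object of [B5] (1.71)/(1.74) — the SOFT MINIMISER MAP
`B ↦ A₀ = a n^d 𝒢 Q_kᴴ B` of the exponent of (1.68) (King's `a_kG_kQ_k*`, [King1986] (4.2); object X3 of the cell record
`t4/T4-XREAD-U1a.md`) — maps the unit lattice INTO the fine lattice, so its η-comparison needs an injection between consecutive
fine lattices.  With King's pairing «When x′ ∈ T_{η′}, we denote by x that point in T_η for which x′ ∈ B^n(x)» (p. 664) the
injection is the piecewise-constant extension `E = R^d Q_Rᴴ` (`(Eg)(x′) = g(par x′)`), and the one-step comparison reduces to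
the MIXED LAW of the companion leaf, whose proof needs — besides file 2 — that a propagator is close to its block means: the block Poincaré
inequality of §3, proved here WITHOUT eigenvalue analysis:

 * §1 translations `transl v` by an arbitrary torus vector (permutation matrices, `‖·‖ ≤ 1`, `transl (u+v) = transl u · transl v`),
   the defect bounds `‖(transl (t e_ν) − 1)X‖ ≤ t·δ`, `‖(transl (off j) − 1)X‖ ≤ d·R·δ` from `‖(S^ν − 1)X‖ ≤ δ ∀ν`;
 * §2 the BOX TRANSLATION AVERAGE `boxAvg = R^{−d} Σ_{j∈[0,R)^d} transl (off j)` and `‖(boxAvg − 1)X‖ ≤ d·R·δ`;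
 * §3 the BLOCK-MEAN PROJECTOR `Pi = R^d Q_Rᴴ Q_R`: the adjoint formula `(Q_Rᴴ Y)(x′) = R^{−d} Y(par x′)` (every fine site has one
   block parent, file 4), the KEY IDENTITY `(boxAvg X − Pi X)(x′) = (Q_R (transl(off (rem x′)) − 1) X)(par x′)` (block mean = box
   average seen from the block corner), the tiling reindexing `x′ ↔ (par x′, rem x′)`, and `‖Q_R h‖² ≤ R^{−d}‖h‖²` give
   **`opNorm_boxAvg_sub_Pi_mul_le`** `‖(boxAvg − Pi)X‖ ≤ d·R·δ` and **`opNorm_one_sub_Pi_mul_le`** `‖(1 − Pi)X‖ ≤ 2d·R·δ`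
   — with `δ = C/(RN)` for `‖∇^{(RN)}X‖ ≤ C`: `2d·C·η`, uniformly in `R`;
 * the MIXED LAW `‖𝒢^{(η/R)} QBᴴ − Q_Rᴴ 𝒢^{(η)}‖ ≤ R^{−d/2}·(CQ + 3d·Cst)·η` built on §3 and the minimiser-map tower are the
   companion leaf `Support/BalabanMinimizerLaw` (file 7 of the generation; split for the 400-line cap).

HONEST FRAMING (T4-DAG p. 1).  `U = 1`, FIXED FINITE torus, linear layer, operator norm; statements and constants OURS
([folklore]); Bałaban prints no rate, King's Prop. 3.8 (3.71) is the scalar A = 0 template for the object of §4.  NOT `U ≠ 1`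
(open row G-an2-4, typed in `Spine/CovariantAveragingTower`), NOT infinite volume, NOT a mass gap, NOT Clay, NOT summit
progress.  HONEST DEPENDENCY: continuum YM on T⁴ ⇐ BetaPertH ∧ nine spine estimates (0/9 proved); BetaPertH ⇐ (D1) ∧ (D4) ∧
CAP+tail; G-an2-4 gates asym, D1 and NE2/3/4.  ABSOLUTE RULE kept; no `sorry`.
-/

noncomputable section

open scoped BigOperators ComplexConjugate Matrix Matrix.Norms.L2Operator
open Finset

namespace Summit.QuantumFields.BalabanUV.T4Continuum.BalabanBlockPoincare

open Literature.MathematicalPhysics.QuantumFieldTheory.Balaban1983to89.B5Prop11Plancherel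
open Literature.MathematicalPhysics.QuantumFieldTheory.Balaban1983to89.B5Prop11Lower (nsq nsq_nonneg nsq_mulVec_le)
open Literature.MathematicalPhysics.QuantumFieldTheory.Balaban1983to89.B5Block118 (tstep tstep_zero tstep_succ)
open Literature.MathematicalPhysics.QuantumFieldTheory.Balaban1983to89.B5G183RateOp (opNorm_le_of_schur)
open Literature.MathematicalPhysics.QuantumFieldTheory.Balaban1983to89.B5G183RateTorus (cpt CT_nonneg)
open Literature.MathematicalPhysics.QuantumFieldTheory.Balaban1983to89.B5G183RateTorusW
open Summit.QuantumFields.BalabanUV.T4Continuum.BalabanLineAverage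
open Summit.QuantumFields.BalabanUV.T4Continuum.BalabanAveragedTowerModes (par rem val_par cpt_par_add_off_rem
  par_cpt_add_off rem_cpt_add_off eq_par_rem_of_eq star_Qavg_apply)

variable {d : ℕ}

/-! ## §1 Translations by arbitrary torus vectors and their defects -/

section Transl

variable (Nf : Fin d → ℕ) [hNf : ∀ μ, NeZero (Nf μ)]

/-- TRANSLATION by the torus vector `v` (all components): `(T_v A)_μ(x) = A_μ(x + v)`. [folklore] -/
def transl (v : Tor Nf) : Matrix (Tor Nf × Fin d) (Tor Nf × Fin d) ℂ :=
  fun i x => if x = (i.1 + v, i.2) then 1 else 0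

/-- rows of `T_v X`. [folklore] -/
theorem transl_mul_apply {β : Type*} (v : Tor Nf) (X : Matrix (Tor Nf × Fin d) β ℂ) (i : Tor Nf × Fin d) (b : β) :
    (transl Nf v * X) i b = X (i.1 + v, i.2) b := by
  simp only [Matrix.mul_apply, transl, ite_mul, one_mul, zero_mul]
  rw [Finset.sum_ite_eq' Finset.univ (i.1 + v, i.2) (fun j => X j b)]
  simp

omit hNf in
/-- `T_0 = 1`. [folklore] -/
theorem transl_zero : transl Nf 0 = 1 := by
  ext i j
  simp only [transl, add_zero, Prod.mk.eta, Matrix.one_apply]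
  by_cases h : i = j
  · simp [h]
  · rw [if_neg (fun hh => h hh.symm), if_neg h]

/-- `T_{u+v} = T_u T_v`. [folklore] -/
theorem transl_add (u v : Tor Nf) : transl Nf (u + v) = transl Nf u * transl Nf v := by
  ext i j
  rw [transl_mul_apply]
  simp only [transl, add_assoc]

omit hNf in
/-- `S^ν = T_{e_ν}` (`B5Prop11Plancherel.shiftM`). [folklore] -/
theorem shiftM_eq_transl (ν : Fin d) : shiftM Nf ν = transl Nf (unitVec Nf ν) := rfl

omit hNf in
/-- `T_v i = j ↔ i = T_{−v} j`. [folklore] -/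
theorem transl_eq_iff (v : Tor Nf) (i j : Tor Nf × Fin d) : j = (i.1 + v, i.2) ↔ i = (j.1 - v, j.2) := by
  constructor
  · intro h; rw [h]; simp
  · intro h; rw [h]; simp

/-- `‖T_v‖ ≤ 1` (permutation matrix, Schur test). [folklore] -/
theorem opNorm_transl_le (v : Tor Nf) : ‖transl Nf v‖ ≤ 1 := by
  refine opNorm_le_of_schur _ zero_le_one (fun i => ?_) (fun j => ?_)
  · simp only [transl]
    rw [Finset.sum_eq_single (i.1 + v, i.2)]
    · simp
    · intro j _ hj; rw [if_neg hj, norm_zero]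
    · intro h; exact absurd (Finset.mem_univ _) h
  · simp only [transl]
    simp_rw [transl_eq_iff Nf v _ j]
    rw [Finset.sum_eq_single (j.1 - v, j.2)]
    · simp
    · intro i _ hi; rw [if_neg hi, norm_zero]
    · intro h; exact absurd (Finset.mem_univ _) h

/-- defect of a translation along one axis: `‖(T_{t e_ν} − 1)X‖ ≤ t·δ` if `‖(S^ν − 1)X‖ ≤ δ`. [folklore] -/
theorem opNorm_transl_tstep_sub_one_mul_le (X : Matrix (Tor Nf × Fin d) (Tor Nf × Fin d) ℂ) (ν : Fin d) {δ : ℝ}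
    (hX : ‖(shiftM Nf ν - 1) * X‖ ≤ δ) (t : ℕ) : ‖(transl Nf (tstep Nf ν t) - 1) * X‖ ≤ t * δ := by
  induction t with
  | zero => simp [tstep_zero, transl_zero]
  | succ t ih =>
    have e : (transl Nf (tstep Nf ν (t + 1)) - 1) * X
        = transl Nf (tstep Nf ν t) * ((shiftM Nf ν - 1) * X) + (transl Nf (tstep Nf ν t) - 1) * X := by
      rw [tstep_succ, transl_add, shiftM_eq_transl]
      simp only [Matrix.sub_mul, Matrix.mul_sub, Matrix.one_mul, Matrix.mul_assoc]
      abel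
    have hδ : 0 ≤ δ := (norm_nonneg _).trans hX
    rw [e]
    calc _ ≤ ‖transl Nf (tstep Nf ν t) * ((shiftM Nf ν - 1) * X)‖ + ‖(transl Nf (tstep Nf ν t) - 1) * X‖ := norm_add_le _ _
      _ ≤ 1 * δ + t * δ := add_le_add ((Matrix.l2_opNorm_mul _ _).trans
          (mul_le_mul (opNorm_transl_le Nf _) hX (norm_nonneg _) zero_le_one)) ih
      _ = ((t + 1 : ℕ) : ℝ) * δ := by push_cast; ring

/-- defect of a translation by a sum of axis vectors: `‖(T_{Σ_{ν∈s} t_ν e_ν} − 1)X‖ ≤ (Σ_{ν∈s} t_ν)·δ`. [folklore] -/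
theorem opNorm_transl_sum_sub_one_mul_le (X : Matrix (Tor Nf × Fin d) (Tor Nf × Fin d) ℂ) {δ : ℝ}
    (hX : ∀ ν, ‖(shiftM Nf ν - 1) * X‖ ≤ δ) (t : Fin d → ℕ) (s : Finset (Fin d)) :
    ‖(transl Nf (∑ ν ∈ s, tstep Nf ν (t ν)) - 1) * X‖ ≤ (∑ ν ∈ s, (t ν : ℝ)) * δ := by
  classical
  induction s using Finset.induction_on with
  | empty => simp [transl_zero]
  | @insert ν s hν ih =>
    rw [Finset.sum_insert hν, Finset.sum_insert hν, add_comm (tstep Nf ν (t ν)), transl_add]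
    have e : (transl Nf (∑ x ∈ s, tstep Nf x (t x)) * transl Nf (tstep Nf ν (t ν)) - 1) * X
        = transl Nf (∑ x ∈ s, tstep Nf x (t x)) * ((transl Nf (tstep Nf ν (t ν)) - 1) * X)
          + (transl Nf (∑ x ∈ s, tstep Nf x (t x)) - 1) * X := by
      simp only [Matrix.sub_mul, Matrix.mul_sub, Matrix.one_mul, Matrix.mul_assoc]
      abel
    rw [e]
    have h1 := opNorm_transl_tstep_sub_one_mul_le Nf X ν (hX ν) (t ν)
    have h0 : (0 : ℝ) ≤ δ := by have := hX ν; exact (norm_nonneg _).trans this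
    calc _ ≤ ‖transl Nf (∑ x ∈ s, tstep Nf x (t x)) * ((transl Nf (tstep Nf ν (t ν)) - 1) * X)‖
            + ‖(transl Nf (∑ x ∈ s, tstep Nf x (t x)) - 1) * X‖ := norm_add_le _ _
      _ ≤ 1 * ((t ν : ℝ) * δ) + (∑ x ∈ s, (t x : ℝ)) * δ := by
          refine add_le_add ?_ ih
          exact (Matrix.l2_opNorm_mul _ _).trans
            (mul_le_mul (opNorm_transl_le Nf _) h1 (norm_nonneg _) zero_le_one)
      _ = ((t ν : ℝ) + ∑ x ∈ s, (t x : ℝ)) * δ := by ring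

end Transl

/-! ## §2 Two levels: the box translation average and its defect -/

section TwoLevel

variable (N R : ℕ) [NeZero N] [NeZero R] (M : Fin d → ℕ) [hM : ∀ μ, NeZero (M μ)]

omit [NeZero N] [NeZero R] hM in
/-- the offset vector is the sum of its axis components: `off j = Σ_ν j_ν e_ν`. [folklore] -/
theorem off_eq_sum_tstep (j : Fin d → Fin R) :
    off N R M j = ∑ ν, tstep (fine (R * N) M) ν (j ν : ℕ) := by
  funext μ
  rw [Finset.sum_apply, Finset.sum_eq_single μ]
  · simp [off, tstep]
  · intro ν _ hν; simp [tstep, Ne.symm hν]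
  · intro h; exact absurd (Finset.mem_univ _) h

/-- defect of the translation by a block offset: `‖(T_{off j} − 1)X‖ ≤ d·R·δ` (`0 ≤ δ`). [folklore] -/
theorem opNorm_transl_off_sub_one_mul_le (X : Matrix (Tor (fine (R * N) M) × Fin d) (Tor (fine (R * N) M) × Fin d) ℂ)
    {δ : ℝ} (hδ : 0 ≤ δ) (hX : ∀ ν, ‖(shiftM (fine (R * N) M) ν - 1) * X‖ ≤ δ) (j : Fin d → Fin R) :
    ‖(transl (fine (R * N) M) (off N R M j) - 1) * X‖ ≤ d * R * δ := by
  rw [off_eq_sum_tstep N R M j]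
  refine (opNorm_transl_sum_sub_one_mul_le (fine (R * N) M) X hX (fun ν => (j ν : ℕ)) Finset.univ).trans ?_
  have hs : ∑ ν : Fin d, ((j ν : ℕ) : ℝ) ≤ d * R := by
    calc ∑ ν : Fin d, ((j ν : ℕ) : ℝ) ≤ ∑ _ν : Fin d, (R : ℝ) :=
          Finset.sum_le_sum fun ν _ => by exact_mod_cast (j ν).isLt.le
      _ = d * R := by rw [Finset.sum_const, Finset.card_univ, Fintype.card_fin, nsmul_eq_mul]
  exact mul_le_mul_of_nonneg_right hs hδ

/-- the BOX TRANSLATION AVERAGE over the offsets of an `R`-block: `(U f)(x) = R^{−d} Σ_{j∈[0,R)^d} f(x + j)`. [folklore] -/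
def boxAvg : Matrix (Tor (fine (R * N) M) × Fin d) (Tor (fine (R * N) M) × Fin d) ℂ :=
  ((R : ℂ) ^ d)⁻¹ • ∑ j : Fin d → Fin R, transl (fine (R * N) M) (off N R M j)

/-- rows of `U X`. [folklore] -/
theorem boxAvg_mul_apply {β : Type*} (X : Matrix (Tor (fine (R * N) M) × Fin d) β ℂ) (x : Tor (fine (R * N) M) × Fin d)
    (b : β) : (boxAvg N R M * X) x b = ((R : ℂ) ^ d)⁻¹ * ∑ j : Fin d → Fin R, X (x.1 + off N R M j, x.2) b := by
  rw [boxAvg, Matrix.smul_mul, Matrix.sum_mul, Matrix.smul_apply, Matrix.sum_apply, smul_eq_mul]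
  simp_rw [transl_mul_apply]

/-- `‖(U − 1)X‖ ≤ d·R·δ`. [folklore] -/
theorem opNorm_boxAvg_sub_one_mul_le (X : Matrix (Tor (fine (R * N) M) × Fin d) (Tor (fine (R * N) M) × Fin d) ℂ)
    {δ : ℝ} (hδ : 0 ≤ δ) (hX : ∀ ν, ‖(shiftM (fine (R * N) M) ν - 1) * X‖ ≤ δ) :
    ‖(boxAvg N R M - 1) * X‖ ≤ d * R * δ := by
  have hRd : ((R : ℂ) ^ d) ≠ 0 := pow_ne_zero _ (by exact_mod_cast NeZero.ne R)
  have hRr : (0 : ℝ) < (R : ℝ) ^ d := pow_pos (by exact_mod_cast Nat.pos_of_ne_zero (NeZero.ne R)) d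
  have e : boxAvg N R M - 1 = ((R : ℂ) ^ d)⁻¹ • ∑ j : Fin d → Fin R, (transl (fine (R * N) M) (off N R M j) - 1) := by
    rw [Finset.sum_sub_distrib, Finset.sum_const, Finset.card_univ, Fintype.card_fun, Fintype.card_fin, Fintype.card_fin,
      smul_sub, boxAvg, ← Nat.cast_smul_eq_nsmul ℂ, smul_smul, Nat.cast_pow, inv_mul_cancel₀ hRd, one_smul]
  rw [e, Matrix.smul_mul, Finset.sum_mul, norm_smul, norm_inv, norm_pow, Complex.norm_natCast]
  calc ((R : ℝ) ^ d)⁻¹ * ‖∑ j : Fin d → Fin R, (transl (fine (R * N) M) (off N R M j) - 1) * X‖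
      ≤ ((R : ℝ) ^ d)⁻¹ * ∑ j : Fin d → Fin R, ‖(transl (fine (R * N) M) (off N R M j) - 1) * X‖ :=
        mul_le_mul_of_nonneg_left (norm_sum_le _ _) (inv_nonneg.mpr hRr.le)
    _ ≤ ((R : ℝ) ^ d)⁻¹ * ∑ _j : Fin d → Fin R, (d * R * δ : ℝ) :=
        mul_le_mul_of_nonneg_left (Finset.sum_le_sum fun j _ => opNorm_transl_off_sub_one_mul_le N R M X hδ hX j)
          (inv_nonneg.mpr hRr.le)
    _ = d * R * δ := by
        rw [Finset.sum_const, Finset.card_univ, Fintype.card_fun, Fintype.card_fin, Fintype.card_fin, nsmul_eq_mul,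
          Nat.cast_pow, ← mul_assoc, inv_mul_cancel₀ hRr.ne', one_mul]

/-! ## §3 The block-mean projector and the block Poincaré inequality -/

/-- **`(Q_Rᴴ Y)(x′) = R^{−d}·Y(par x′)`**: the adjoint block averaging reads the block parent (every fine site has exactly one).
[cite: King1986, (2.10) p.653] [folklore] -/
theorem Qavg_conjTranspose_mul_apply {β : Type*} (Y : Matrix (Tor (fine N M) × Fin d) β ℂ)
    (x : Tor (fine (R * N) M) × Fin d) (b : β) :
    ((Qavg N R M)ᴴ * Y) x b = ((R : ℂ) ^ d)⁻¹ * Y (par N R M x.1, x.2) b := by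
  rw [Matrix.mul_apply]
  simp_rw [Matrix.conjTranspose_apply, star_Qavg_apply]
  simp only [Qavg, Finset.sum_mul, Finset.mul_sum]
  rw [Finset.sum_eq_single (par N R M x.1, x.2)]
  · rw [Finset.sum_eq_single (rem N R M x.1)]
    · have hx : x = (cpt N R M (par N R M x.1) + off N R M (rem N R M x.1), x.2) :=
        Prod.ext (cpt_par_add_off_rem N R M x.1).symm rfl
      dsimp only
      rw [if_pos hx, mul_one]
    · intro j _ hj
      dsimp only
      rw [if_neg, mul_zero, zero_mul]
      intro h; exact hj (eq_par_rem_of_eq N R M (i := (par N R M x.1, x.2)) h).2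
    · intro h; exact absurd (Finset.mem_univ _) h
  · intro i _ hi
    refine Finset.sum_eq_zero fun j _ => ?_
    rw [if_neg, mul_zero, zero_mul]
    intro h; exact hi (eq_par_rem_of_eq N R M h).1
  · intro h; exact absurd (Finset.mem_univ _) h

/-- the BLOCK-MEAN PROJECTOR `Π = R^d Q_Rᴴ Q_R` (orthogonal projector onto `R`-block-constant vector fields; `Q_R` = King's block
averaging (2.10); the projector and its name are ours — v1.0.1: no printed string is quoted here). [cite: King1986, (2.10) p.653]
[folklore] -/
def Pi : Matrix (Tor (fine (R * N) M) × Fin d) (Tor (fine (R * N) M) × Fin d) ℂ :=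
  ((R : ℂ) ^ d) • ((Qavg N R M)ᴴ * Qavg N R M)

/-- rows of `Π X`: block means. [folklore] -/
theorem Pi_mul_apply {β : Type*} (X : Matrix (Tor (fine (R * N) M) × Fin d) β ℂ) (x : Tor (fine (R * N) M) × Fin d) (b : β) :
    (Pi N R M * X) x b = ((R : ℂ) ^ d)⁻¹ * ∑ j : Fin d → Fin R, X (cpt N R M (par N R M x.1) + off N R M j, x.2) b := by
  have hRd : ((R : ℂ) ^ d) ≠ 0 := pow_ne_zero _ (by exact_mod_cast NeZero.ne R)
  rw [Pi, Matrix.smul_mul, Matrix.smul_apply, Matrix.mul_assoc, Qavg_conjTranspose_mul_apply, Qavg_mul_apply,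
    smul_eq_mul, ← mul_assoc, mul_inv_cancel₀ hRd, one_mul]

/-- **KEY IDENTITY**: `(U X − Π X)(x′) = (Q_R (T_{rem x′} − 1) X)(par x′)` — the box average minus the block mean at `x′` is the
block mean, over the block of `x′`, of the defect of the translation by the offset of `x′`. [folklore] -/
theorem boxAvg_sub_Pi_mul_apply {β : Type*} (X : Matrix (Tor (fine (R * N) M) × Fin d) β ℂ)
    (x : Tor (fine (R * N) M) × Fin d) (b : β) :
    ((boxAvg N R M - Pi N R M) * X) x b
      = ((Qavg N R M * ((transl (fine (R * N) M) (off N R M (rem N R M x.1)) - 1) * X) :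
          Matrix (Tor (fine N M) × Fin d) β ℂ) (par N R M x.1, x.2) b) := by
  rw [Matrix.sub_mul, Matrix.sub_apply, boxAvg_mul_apply, Pi_mul_apply, Qavg_mul_apply, ← mul_sub,
    ← Finset.sum_sub_distrib]
  congr 1
  refine Finset.sum_congr rfl fun j _ => ?_
  rw [Matrix.sub_mul, Matrix.sub_apply, transl_mul_apply, Matrix.one_mul]
  have e : cpt N R M (par N R M x.1) + off N R M j + off N R M (rem N R M x.1) = x.1 + off N R M j := by
    rw [add_assoc, add_comm (off N R M j), ← add_assoc, cpt_par_add_off_rem]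
  rw [e]

/-- the BLOCK TILING as an equivalence `(parent, offset) ≃ fine site`. [cite: King1986, (2.10) p.653] [folklore] -/
def tileEquiv : Tor (fine N M) × (Fin d → Fin R) ≃ Tor (fine (R * N) M) where
  toFun p := cpt N R M p.1 + off N R M p.2
  invFun x := (par N R M x, rem N R M x)
  left_inv p := by
    show (par N R M (cpt N R M p.1 + off N R M p.2), rem N R M (cpt N R M p.1 + off N R M p.2)) = p
    rw [par_cpt_add_off, rem_cpt_add_off]
  right_inv x := cpt_par_add_off_rem N R M x

omit [NeZero N] [NeZero R] hM in
/-- `Σ_i |(A v)_i|² ≤ ‖A‖²·Σ_j |v_j|²` for a RECTANGULAR matrix (Mathlib's `Matrix.l2_opNorm_mulVec`). [folklore] -/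
theorem nsq_mulVec_le_rect {m n : Type*} [Fintype m] [DecidableEq m] [Fintype n] [DecidableEq n] (A : Matrix m n ℂ)
    (v : n → ℂ) : nsq (A *ᵥ v) ≤ ‖A‖ ^ 2 * nsq v := by
  set x : EuclideanSpace ℂ n := WithLp.toLp 2 v with hx
  have h1 := Matrix.l2_opNorm_mulVec A x
  have hxv : x.ofLp = v := rfl
  have e1 : ‖(EuclideanSpace.equiv m ℂ).symm (A *ᵥ x.ofLp)‖ ^ 2 = nsq (A *ᵥ v) := by
    rw [EuclideanSpace.norm_sq_eq, hxv]
    rfl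
  have e2 : ‖x‖ ^ 2 = nsq v := by
    rw [EuclideanSpace.norm_sq_eq]
    rfl
  rw [← e1, ← e2, ← mul_pow]
  exact pow_le_pow_left₀ (norm_nonneg _) h1 2

/-- `‖Q_R h‖² ≤ R^{−d}‖h‖²` on vectors. [folklore] -/
theorem nsq_Qavg_mulVec_le (h : Tor (fine (R * N) M) × Fin d → ℂ) :
    nsq (Qavg N R M *ᵥ h) ≤ ((R : ℝ) ^ d)⁻¹ * nsq h := by
  have hRr : (0 : ℝ) ≤ (R : ℝ) ^ d := pow_nonneg (Nat.cast_nonneg _) d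
  refine (nsq_mulVec_le_rect _ h).trans (mul_le_mul_of_nonneg_right ?_ (nsq_nonneg h))
  calc ‖Qavg N R M‖ ^ 2 ≤ ((Real.sqrt ((R : ℝ) ^ d))⁻¹) ^ 2 := pow_le_pow_left₀ (norm_nonneg _) (opNorm_Qavg_le N R M) 2
    _ = ((R : ℝ) ^ d)⁻¹ := by rw [inv_pow, Real.sq_sqrt hRr]

/-- the VECTOR form of the block Poincaré step: `Σ_{x′} |((U − Π)X w)(x′)|² ≤ (dRδ)²·Σ|w|²` — reindex the fine sites by
(parent, offset), use the key identity and `‖Q_R h‖² ≤ R^{−d}‖h‖²` for each of the `R^d` offsets. [folklore] -/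
theorem nsq_boxAvg_sub_Pi_mulVec_le (X : Matrix (Tor (fine (R * N) M) × Fin d) (Tor (fine (R * N) M) × Fin d) ℂ)
    {δ : ℝ} (hδ : 0 ≤ δ) (hX : ∀ ν, ‖(shiftM (fine (R * N) M) ν - 1) * X‖ ≤ δ)
    (w : Tor (fine (R * N) M) × Fin d → ℂ) :
    nsq (((boxAvg N R M - Pi N R M) * X) *ᵥ w) ≤ (d * R * δ) ^ 2 * nsq w := by
  have hRr : (0 : ℝ) < (R : ℝ) ^ d := pow_pos (by exact_mod_cast Nat.pos_of_ne_zero (NeZero.ne R)) d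
  -- the per-offset vectors
  set g : (Fin d → Fin R) → (Tor (fine N M) × Fin d → ℂ) :=
    fun r => Qavg N R M *ᵥ (((transl (fine (R * N) M) (off N R M r) - 1) * X) *ᵥ w) with hg
  have hV : ∀ x : Tor (fine (R * N) M) × Fin d,
      (((boxAvg N R M - Pi N R M) * X) *ᵥ w) x = g (rem N R M x.1) (par N R M x.1, x.2) := by
    intro x
    rw [hg]
    simp only
    rw [Matrix.mulVec_mulVec]
    simp only [Matrix.mulVec, dotProduct]
    refine Finset.sum_congr rfl fun b _ => ?_
    rw [boxAvg_sub_Pi_mul_apply]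
  have hgr : ∀ r, nsq (g r) ≤ ((R : ℝ) ^ d)⁻¹ * ((d * R * δ) ^ 2 * nsq w) := by
    intro r
    refine (nsq_Qavg_mulVec_le N R M _).trans (mul_le_mul_of_nonneg_left ?_ (inv_nonneg.mpr hRr.le))
    refine (nsq_mulVec_le _ w).trans (mul_le_mul_of_nonneg_right ?_ (nsq_nonneg w))
    exact pow_le_pow_left₀ (norm_nonneg _) (opNorm_transl_off_sub_one_mul_le N R M X hδ hX r) 2
  -- reindex the outer sum
  have hre : nsq (((boxAvg N R M - Pi N R M) * X) *ᵥ w) = ∑ r : Fin d → Fin R, nsq (g r) := by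
    unfold nsq
    simp_rw [hV]
    rw [Fintype.sum_prod_type]
    rw [← Fintype.sum_equiv (tileEquiv N R M) (fun p => ∑ μ : Fin d, ‖g (rem N R M (tileEquiv N R M p)) (par N R M (tileEquiv N R M p), μ)‖ ^ 2)
      (fun x₁ => ∑ μ : Fin d, ‖g (rem N R M x₁) (par N R M x₁, μ)‖ ^ 2) (fun p => rfl)]
    simp only [tileEquiv, Equiv.coe_fn_mk, par_cpt_add_off, rem_cpt_add_off]
    rw [Fintype.sum_prod_type, Finset.sum_comm]
    refine Finset.sum_congr rfl fun r _ => ?_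
    rw [Fintype.sum_prod_type]
  rw [hre]
  calc ∑ r : Fin d → Fin R, nsq (g r) ≤ ∑ _r : Fin d → Fin R, ((R : ℝ) ^ d)⁻¹ * ((d * R * δ) ^ 2 * nsq w) :=
        Finset.sum_le_sum fun r _ => hgr r
    _ = (d * R * δ) ^ 2 * nsq w := by
        rw [Finset.sum_const, Finset.card_univ, Fintype.card_fun, Fintype.card_fin, Fintype.card_fin, nsmul_eq_mul,
          Nat.cast_pow, ← mul_assoc, mul_inv_cancel₀ hRr.ne', one_mul]

/-- **`‖(U − Π)X‖ ≤ d·R·δ`** whenever `‖(S^ν − 1)X‖ ≤ δ` for every axis `ν`. [folklore] -/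
theorem opNorm_boxAvg_sub_Pi_mul_le (X : Matrix (Tor (fine (R * N) M) × Fin d) (Tor (fine (R * N) M) × Fin d) ℂ)
    {δ : ℝ} (hδ : 0 ≤ δ) (hX : ∀ ν, ‖(shiftM (fine (R * N) M) ν - 1) * X‖ ≤ δ) :
    ‖(boxAvg N R M - Pi N R M) * X‖ ≤ d * R * δ := by
  refine opNorm_le_of_sq_le _ (by positivity) fun x => ?_
  have h := nsq_boxAvg_sub_Pi_mulVec_le N R M X hδ hX x
  simpa only [nsq, Matrix.mulVec, dotProduct] using h

/-- **THE BLOCK POINCARÉ INEQUALITY, operator form**: `‖(1 − Π)X‖ ≤ 2d·R·δ` whenever `‖(S^ν − 1)X‖ ≤ δ` for every axis — a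
field is within `2d·R·(one-step oscillation)` of its `R`-block means.  With `S^ν − 1 = (RN)⁻¹∇^{(RN)}_ν` and `‖∇X‖ ≤ C`:
`‖(1 − Π)X‖ ≤ 2d·C/N = 2d·C·η`, uniformly in `R`. [folklore] -/
theorem opNorm_one_sub_Pi_mul_le (X : Matrix (Tor (fine (R * N) M) × Fin d) (Tor (fine (R * N) M) × Fin d) ℂ)
    {δ : ℝ} (hδ : 0 ≤ δ) (hX : ∀ ν, ‖(shiftM (fine (R * N) M) ν - 1) * X‖ ≤ δ) :
    ‖(1 - Pi N R M) * X‖ ≤ 2 * (d * R * δ) := by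
  have e : (1 - Pi N R M) * X = -((boxAvg N R M - 1) * X) + (boxAvg N R M - Pi N R M) * X := by
    simp only [Matrix.sub_mul, Matrix.one_mul]; abel
  rw [e]
  calc _ ≤ ‖-((boxAvg N R M - 1) * X)‖ + ‖(boxAvg N R M - Pi N R M) * X‖ := norm_add_le _ _
    _ ≤ d * R * δ + d * R * δ := by
        rw [norm_neg]
        exact add_le_add (opNorm_boxAvg_sub_one_mul_le N R M X hδ hX) (opNorm_boxAvg_sub_Pi_mul_le N R M X hδ hX)
    _ = 2 * (d * R * δ) := by ring

/-- the axis defects of a matrix with bounded lattice gradients: `‖(S^ν − 1)X‖ ≤ C/|c|` from `‖∇^c_νX‖ ≤ C`. [folklore] -/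
theorem opNorm_shiftM_sub_one_mul_le {Nf : Fin d → ℕ} [∀ μ, NeZero (Nf μ)] (X : Matrix (Tor Nf × Fin d) (Tor Nf × Fin d) ℂ)
    {c : ℂ} (hc : c ≠ 0) {C : ℝ} (ν : Fin d) (hX : ‖fdiff Nf c ν * X‖ ≤ C) :
    ‖(shiftM Nf ν - 1) * X‖ ≤ C / ‖c‖ := by
  rw [shiftM_sub_one_eq Nf ν hc, Matrix.smul_mul, norm_smul, norm_inv, div_eq_inv_mul]
  exact mul_le_mul_of_nonneg_left hX (inv_nonneg.mpr (norm_nonneg _))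

end TwoLevel

end Summit.QuantumFields.BalabanUV.T4Continuum.BalabanBlockPoincare

end
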